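import Mathlib
import Summits.Ventures.PercRepro2.Defs
import Summits.Ventures.PercRepro2.Independence
import Summits.Ventures.PercRepro2.Harris
import Summits.Ventures.PercRepro2.Graph
import Summits.Ventures.PercRepro2.Exploration
import Summits.Ventures.PercRepro2.RedFavour
import Summits.Ventures.PercRepro2.RedFavourCluster

/-!
# The NON-FULL pair domination under colour-symmetric weights
(blind cell PercRepro2, p2 g12; paper proofs/P2-G12-NONFULL.md §3)

`RedFavourCluster.prob_pair_blue_red_le_prob_pair_red_blue` compares «`x ~_b y`, `x ∉ C`,
`x, y ∈ D`, `p ~_b q`, `p ≁_r q`» with the same event at `p, q` with the colours exchanged.  When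
the weights are colour-symmetric (`pbar wt = wt`, i.e. every edge is red or blue with the same
probability — the uniform measure), the global colour reflection turns the right-hand side into
«`x ~_r y`, `x ∉ D`, `x, y ∈ C`, `p ~_b q`, `p ≁_r q`», and the theorem reads literally as the
lane's statement: among the colourings with `σ = +1`,

  #{`x, y` red-only and blue-connected} ≤ #{`x, y` blue-only and red-connected}.

(`redJoined`, `pairBlue`, `notBlueJoined` are the events of `RedFavour` / `RedFavourCluster`;
their colour mirrors are defined here.)
-/

namespace Summit.Ventures.PercRepro2

namespace RedFavour

section Mirror

variable {V : Type*} {E : Type*}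

/-- `x` and `y` are red-connected. -/
def pairRed (ends : E → Sym2 V) (x y : V) : Set (Config E) := {ω | Conn ends ω x y}

/-- `x` is not red-joined to `p` nor to `q` (`x ∉ D`). -/
def notRedJoined (ends : E → Sym2 V) (p q x : V) : Set (Config E) :=
  {ω | ¬ Conn ends ω p x ∧ ¬ Conn ends ω q x}

/-- Every vertex of `W` is blue-joined to `p` or to `q`. -/
def blueJoined (ends : E → Sym2 V) (p q : V) (W : Set V) : Set (Config E) :=
  {ω | ∀ w ∈ W, Conn ends (flip ω) p w ∨ Conn ends (flip ω) q w}

/-- The reflection exchanges `pairBlue` and `pairRed`. -/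
lemma preimage_flip_pairBlue (ends : E → Sym2 V) (x y : V) :
    flip ⁻¹' pairBlue ends x y = pairRed ends x y := by
  ext ω; simp [pairBlue, pairRed, flip_flip]

/-- The reflection exchanges `notBlueJoined` and `notRedJoined`. -/
lemma preimage_flip_notBlueJoined (ends : E → Sym2 V) (p q x : V) :
    flip ⁻¹' notBlueJoined ends p q x = notRedJoined ends p q x := by
  ext ω; simp [notBlueJoined, notRedJoined, flip_flip]

/-- The reflection exchanges `redJoined` and `blueJoined`. -/
lemma preimage_flip_redJoined (ends : E → Sym2 V) (p q : V) (W : Set V) :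
    flip ⁻¹' redJoined ends p q W = blueJoined ends p q W := by
  ext ω; simp [redJoined, blueJoined]

/-- The reflection exchanges «`p ~_r q`, `p ≁_b q`» and «`p ~_b q`, `p ≁_r q`». -/
lemma preimage_flip_red_blue (ends : E → Sym2 V) (p q : V) :
    flip ⁻¹' (redConn ends p q ∩ (blueConn ends p q)ᶜ) =
      blueConn ends p q ∩ (redConn ends p q)ᶜ := by
  unfold blueConn redConn
  rw [Set.preimage_inter, Set.preimage_compl, preimage_flip_flip]

end Mirror

section Symmetric

variable {V : Type*} {E : Type*} [Fintype E] [DecidableEq E] {R : Type*} [CommRing R]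
  [PartialOrder R] [IsStrictOrderedRing R]

omit [PartialOrder R] [IsStrictOrderedRing R] in
/-- Under colour-symmetric weights the reflection preserves every probability. -/
lemma prob_preimage_flip_of_symm {wt : E → R} (hsym : pbar wt = wt) (A : Set (Config E)) :
    prob wt (flip ⁻¹' A) = prob wt A := by
  rw [prob_preimage_flip, hsym]

/-- **(NF2), colour-symmetric form.** For colour-symmetric admissible weights (`pbar wt = wt`,
the uniform measure), marks `p, q` and vertices `x, y`:
P(`x ~_b y`, `x ∉ C`, `x, y ∈ D`, `p ~_b q`, `p ≁_r q`)
  ≤ P(`x ~_r y`, `x ∉ D`, `x, y ∈ C`, `p ~_b q`, `p ≁_r q`)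
— among the colourings in which `p, q` are blue-connected and red-disconnected, «`x, y` red-only
and blue-connected» is at most as likely as «`x, y` blue-only and red-connected». -/
theorem prob_pair_blue_red_le_prob_pair_red_blue_symm [Fintype V] [DecidableEq V]
    (ends : E → Sym2 V) (p q x y : V) {wt : E → R} (hwt : IsProbVec wt) (hsym : pbar wt = wt) :
    prob wt (pairBlue ends x y ∩ notBlueJoined ends p q x ∩
        (blueConn ends p q ∩ (redConn ends p q)ᶜ) ∩ redJoined ends p q {x, y}) ≤
      prob wt (pairRed ends x y ∩ notRedJoined ends p q x ∩
        (blueConn ends p q ∩ (redConn ends p q)ᶜ) ∩ blueJoined ends p q {x, y}) := by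
  have hhalf : ∀ e, 1 - wt e ≤ wt e := fun e => by
    have := congrFun hsym e
    simp only [pbar_apply] at this
    rw [this]
  refine (prob_pair_blue_red_le_prob_pair_red_blue ends p q x y hwt hhalf).trans (le_of_eq ?_)
  rw [← prob_preimage_flip_of_symm hsym, Set.preimage_inter, Set.preimage_inter,
    Set.preimage_inter, preimage_flip_pairBlue, preimage_flip_notBlueJoined,
    preimage_flip_red_blue, preimage_flip_redJoined]

end Symmetric

end RedFavour

end Summit.Ventures.PercRepro2
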